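import Summits.CriticalPhenomena.PercolationContinuityZ3.Theorems.PercNearOneGluingNoHeavyPcintUFibFactor
import Summits.CriticalPhenomena.PercolationContinuityZ3.Theorems.PercNearOneGluingNoHeavyPcintTFibDominating
import HarnessLib

/-!
# PCINT lane, T-fibre route PHASE 2, step (3bU): the one-step law of the usable-set process

Cell `prim-pcint`, seat `prim-pcint-1` (gen 12); memo `run/shared/lean/prim/pcint/T-FIBRE-ROUTE.md` (PHASE 2).
Finite-sum lemmas, no new facts, no `sorry`; the analogue of `…PcintTFibStep.lean` for usable sets.

After the fibre factorisation (`UFib.fibU_mixG_iff`), one step of the usable-set process with selected parent `c` of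
TYPE `H` (the usable set of its examiner) reads: the fibre state `x = u c` is `π_p^{Φ}`-distributed CONDITIONED on
`meetsU x H`, and the children `a ∈ C` report `meetsU (u a) (υ x H)` for fresh fibre states `u a`: i.i.d. bits with success
probability `1 - (1-p)^{#υ x H}` (`sum_wt_filter_meetsU`, the law of one read).  Hence

* `UFib.sum_pw_meetsU_pattern` — `Σ_u pw(u) [meetsU (u c) H] g(pattern) = Σ_x π_p(x) [meetsU x H] · E_{π_{q(x)}}[g]`,
  `q(x) = 1 - (1-p)^{#υ x H}`;
* `AdaptDom.dominance_of_factorisation₂` — the variant of `AdaptDom.dominance_of_factorisation` in which the payoff on the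
  resampled fibre may also depend on the non-resampled coordinates (through the type `H`).
-/

namespace Summit.CriticalPhenomena.PercolationContinuityZ3.Theorems.Pcint

open Finset

/-! ### Dominance of factorised fibres, payoff depending on both parts -/

namespace AdaptDom

variable {V : Type*} [Fintype V] [DecidableEq V] {S : Type*} [Fintype S] [DecidableEq S]

omit [DecidableEq S] in
/-- **Factorised fibres dominate if their `u`-integrals do** (payoff `K u w` may depend on the kept coordinates `w`):
if `T (mixG W u w) ↔ Trest w ∧ Ψ u w`, `G (mixG W u w) = K u w` on `Ψ`, and for every `w` the `u`-integral of
`𝟙[Ψ u w] K u w` dominates `E` times that of `𝟙[Ψ u w]`, then `(Σ_{T} pw) · E ≤ Σ_{T} pw · G`. -/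
theorem dominance_of_factorisation₂ (m : V → S → ℝ) (hm1 : ∀ v, ∑ s, m v s = 1) (hm0 : ∀ v s, 0 ≤ m v s)
    (W : Finset V) (T : (V → S) → Prop) [DecidablePred T] (Trest : (V → S) → Prop) [DecidablePred Trest]
    (Ψ : (V → S) → (V → S) → Prop) [∀ u w, Decidable (Ψ u w)] (hfac : ∀ u w, T (mixG W u w) ↔ Trest w ∧ Ψ u w)
    (G : (V → S) → ℝ) (K : (V → S) → (V → S) → ℝ) (hG : ∀ u w, Ψ u w → G (mixG W u w) = K u w) (E : ℝ)
    (hdom : ∀ w, (∑ u, pw m u * (if Ψ u w then 1 else 0)) * E ≤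
      ∑ u, pw m u * ((if Ψ u w then 1 else 0) * K u w)) :
    (∑ w, pw m w * (if T w then (1 : ℝ) else 0)) * E ≤ ∑ w, pw m w * ((if T w then (1 : ℝ) else 0) * G w) := by
  rw [sum_pw_mixG m hm1 W (fun w => if T w then (1 : ℝ) else 0),
    sum_pw_mixG m hm1 W (fun w => (if T w then (1 : ℝ) else 0) * G w)]
  have e1 : ∀ w, ∑ u, pw m u * (if T (mixG W u w) then (1 : ℝ) else 0) =
      (if Trest w then 1 else 0) * ∑ u, pw m u * (if Ψ u w then 1 else 0) := by
    intro w
    rw [Finset.mul_sum]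
    refine Finset.sum_congr rfl fun u _ => ?_
    by_cases h1 : Trest w
    · by_cases h2 : Ψ u w
      · rw [if_pos ((hfac u w).2 ⟨h1, h2⟩), if_pos h1, if_pos h2]; ring
      · rw [if_neg (fun h => h2 ((hfac u w).1 h).2), if_pos h1, if_neg h2]; ring
    · rw [if_neg (fun h => h1 ((hfac u w).1 h).1), if_neg h1]; ring
  have e2 : ∀ w, ∑ u, pw m u * ((if T (mixG W u w) then (1 : ℝ) else 0) * G (mixG W u w)) =
      (if Trest w then 1 else 0) * ∑ u, pw m u * ((if Ψ u w then 1 else 0) * K u w) := by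
    intro w
    rw [Finset.mul_sum]
    refine Finset.sum_congr rfl fun u _ => ?_
    by_cases h1 : Trest w
    · by_cases h2 : Ψ u w
      · rw [if_pos ((hfac u w).2 ⟨h1, h2⟩), if_pos h1, if_pos h2, hG u w h2]; ring
      · rw [if_neg (fun h => h2 ((hfac u w).1 h).2), if_pos h1, if_neg h2]; ring
    · rw [if_neg (fun h => h1 ((hfac u w).1 h).1), if_neg h1]; ring
  simp_rw [e1, e2]
  rw [Finset.sum_mul]
  refine Finset.sum_le_sum fun w _ => ?_
  have hw : 0 ≤ pw m w := pw_nonneg hm0 w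
  by_cases h1 : Trest w
  · rw [if_pos h1, one_mul, one_mul, mul_assoc]
    exact mul_le_mul_of_nonneg_left (hdom w) hw
  · rw [if_neg h1]; simp

end AdaptDom

/-! ### The one-step law of the usable-set process -/

namespace UFib

open AdaptDom TFib

variable {Φ : Type*} [Fintype Φ] [DecidableEq Φ]

/-- `meetsU (𝟙_A) U = false ↔ A ⊆ Uᶜ`. -/
theorem meetsU_indB_eq_false_iff (U : Finset Φ) (A : Finset Φ) :
    meetsU (indB A) U = false ↔ A ∈ Uᶜ.powerset := by
  rw [mem_powerset, ← Bool.not_eq_true, meetsU_eq_true_iff]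
  simp only [indB_apply_eq_true, not_exists, not_and]
  constructor
  · intro h a ha; exact mem_compl.2 fun haU => h a haU ha
  · intro h a haU ha; exact (mem_compl.1 (h ha)) haU

/-- **The law of one read**: the `π_p`-probability that a fresh fibre state meets the set `U` is `1 - (1-p)^{#U}`. -/
theorem sum_wt_filter_meetsU (p : ℝ) (U : Finset Φ) :
    ∑ y ∈ univ.filter (fun y : Φ → Bool => meetsU y U = true), wt p y = 1 - (1 - p) ^ U.card := by
  classical
  have htot := sum_wt (V := Φ) p
  rw [← Finset.sum_filter_add_sum_filter_not univ (fun y : Φ → Bool => meetsU y U = true)] at htot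
  have hno : ∑ y ∈ univ.filter (fun y : Φ → Bool => ¬ meetsU y U = true), wt p y = (1 - p) ^ U.card := by
    have e1 : ∑ y ∈ univ.filter (fun y : Φ → Bool => ¬ meetsU y U = true), wt p y =
        ∑ y : Φ → Bool, wt p y * (if meetsU y U = false then 1 else 0) := by
      rw [Finset.sum_filter]
      refine Finset.sum_congr rfl fun y _ => ?_
      by_cases h : meetsU y U = true
      · rw [if_neg (not_not.2 h), if_neg (by rw [h]; decide), mul_zero]
      · rw [if_pos h, if_pos (Bool.eq_false_iff.2 h), mul_one]
    rw [e1, sum_wt_eq_sum_finset]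
    have e2 : ∑ A : Finset Φ, p ^ A.card * (1 - p) ^ (Fintype.card Φ - A.card) *
        (if meetsU (indB A) U = false then (1 : ℝ) else 0) =
        ∑ A ∈ Uᶜ.powerset, p ^ A.card * (1 - p) ^ (Fintype.card Φ - A.card) := by
      rw [← Finset.sum_filter_of_ne (s := univ) (p := fun A => A ∈ Uᶜ.powerset)
        (fun A _ hA => by
          by_contra hA'
          rw [← meetsU_indB_eq_false_iff] at hA'
          exact hA (by rw [if_neg hA', mul_zero]))]
      refine Finset.sum_congr (by ext A; simp) fun A hA => ?_
      rw [if_pos ((meetsU_indB_eq_false_iff U A).2 hA), mul_one]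
    rw [e2]
    set T := Uᶜ with hT
    have hTc : T.card = Fintype.card Φ - U.card := card_compl _
    have hle : U.card ≤ Fintype.card Φ := card_le_univ _
    have e3 : ∀ A ∈ T.powerset, p ^ A.card * (1 - p) ^ (Fintype.card Φ - A.card) =
        (1 - p) ^ U.card * (p ^ A.card * (1 - p) ^ (T.card - A.card)) := by
      intro A hA
      have hA' : A.card ≤ T.card := card_le_card (mem_powerset.1 hA)
      have : Fintype.card Φ - A.card = U.card + (T.card - A.card) := by omega
      rw [this, pow_add]; ring
    rw [Finset.sum_congr rfl e3, ← Finset.mul_sum, Finset.sum_pow_mul_eq_add_pow]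
    ring
  rw [hno] at htot
  linarith

variable (υ : (Φ → Bool) → Finset Φ → Finset Φ) {V : Type*} [Fintype V] [DecidableEq V] (p : ℝ)

/-- **The one-step law, integrated**: with type `H` and the children pattern `a ↦ meetsU (u a) (υ (u c) H)`,
`Σ_u pw(u) [meetsU (u c) H] g(pattern) = Σ_x π_p(x) [meetsU x H] · E_{π_{1-(1-p)^{#υ x H}}}[g]`. -/
theorem sum_pw_meetsU_pattern (H : Finset Φ) (c : V) (C : Finset V) (hc : c ∉ C)
    {g : (V → Bool) → ℝ} (hg : StepTest C g) :
    ∑ u : V → (Φ → Bool), pw (fun _ => wt p) u *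
        ((if meetsU (u c) H = true then (1 : ℝ) else 0) * g (fun a => if a ∈ C then meetsU (u a) (υ (u c) H) else false)) =
      ∑ x : Φ → Bool, wt p x * (if meetsU x H = true then (1 : ℝ) else 0) *
        ∑ ω : V → Bool, wt (1 - (1 - p) ^ (υ x H).card) ω * g ω := by
  rw [sum_pw_resample (fun _ => wt p) (fun _ => sum_wt p) c]
  have e1 : ∀ (u : V → (Φ → Bool)) (x : Φ → Bool),
      (if meetsU (Function.update u c x c) H = true then (1 : ℝ) else 0) *
        g (fun a => if a ∈ C then meetsU (Function.update u c x a) (υ (Function.update u c x c) H) else false) =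
      (if meetsU x H = true then (1 : ℝ) else 0) * g (fun a => if a ∈ C then meetsU (u a) (υ x H) else false) := by
    intro u x
    rw [Function.update_self]
    congr 1
    refine hg.2 _ _ fun a ha => ?_
    have hac : a ≠ c := fun h => hc (h ▸ ha)
    rw [Function.update_of_ne hac]
  simp_rw [e1]
  rw [show (∑ u : V → (Φ → Bool), pw (fun _ => wt p) u * ∑ x, wt p x *
      ((if meetsU x H = true then (1 : ℝ) else 0) * g (fun a => if a ∈ C then meetsU (u a) (υ x H) else false))) =
      ∑ x, wt p x * (if meetsU x H = true then (1 : ℝ) else 0) *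
        ∑ u : V → (Φ → Bool), pw (fun _ => wt p) u * g (fun a => if a ∈ C then meetsU (u a) (υ x H) else false) by
    simp_rw [Finset.mul_sum]; rw [Finset.sum_comm]
    exact Finset.sum_congr rfl fun x _ => Finset.sum_congr rfl fun u _ => by ring]
  refine Finset.sum_congr rfl fun x _ => ?_
  rw [sum_pw_pat_eq_sum_wt (wt p) (sum_wt p) (1 - (1 - p) ^ (υ x H).card) (fun _ s => meetsU s (υ x H)) C
    (fun a _ => sum_wt_filter_meetsU p (υ x H)) g hg]

/-- The same with `g ≡ 1`: `Σ_u pw(u) [meetsU (u c) H] = Σ_x π_p(x) [meetsU x H]`. -/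
theorem sum_pw_meetsU (H : Finset Φ) (c : V) :
    ∑ u : V → (Φ → Bool), pw (fun _ => wt p) u * (if meetsU (u c) H = true then (1 : ℝ) else 0) =
      ∑ x : Φ → Bool, wt p x * (if meetsU x H = true then (1 : ℝ) else 0) := by
  have h := sum_pw_mul_blind (fun (_ : V) => wt p) (fun _ => sum_wt p) c
    (fun x => if meetsU x H = true then (1 : ℝ) else 0) (fun _ => 1) (fun _ _ => rfl)
  simp only [mul_one] at h
  rw [h, sum_pw (fun _ => sum_wt p), mul_one]

end UFib

end Summit.CriticalPhenomena.PercolationContinuityZ3.Theorems.Pcint
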